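import Literature.NumberTheory.Irrationality.Hata1992.TruncatedStepFactor
import HarnessLib

/-!
# Truncated savings factors with a GROWING cut-off

Topic `Literature/NumberTheory/Irrationality/Hata1992`. HONEST FRAMING (cell `pub-zeta5`): systematic search; no irrationality claim
unless certified. Nothing here concerns the arithmetic nature of any constant.

Sequel of `TruncatedStepFactor` (Zudilin's truncated `Φ_n`, [cite: Zudilin2004, §8 (8.8)–(8.9), Lemma 11; Hata1992, §2 pp. 340–341]).
A user whose valuation laws hold only for primes with `p² > C·n` takes the cut-off `K(n) = ⌊√(n/C)⌋ − 1`, which GROWS with `n`; the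
rate statement then needs only monotonicity of the truncated factor in `K`:
* `fracProdTrunc_dvd_of_le`, `stepFactorTrunc_dvd_of_le` — divisibility (hence `≤`) in the cut-off;
* **`eventually_exp_le_stepFactorTrunc_of_tendsto`** — `K(n) → ∞` ⇒ `e^{(Σ c_i S(u_i,v_i,k₀) − ε)n} ≤ stepFactorTrunc … (K n) n` eventually;
(The companion RATIONAL minorant of the rate, `(v − u)/(m₀ − 1/2 + 1/(8m₀) + (u+v)/2) ≤ S(u, v, m₀) = ψ(m₀+v) − ψ(m₀+u)` for
`0 < u ≤ v`, `m₀ ≥ 1`, is Summit-side: `RayC1.fracRate_ge_sharp` in `Summits/…/Zeta5Search/Certificates/RayC1KernelStepTailSharp`.)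

## References
* [Zudilin2004] W. Zudilin, J. Théor. Nombres Bordeaux 16 (2004) 251–291, §8 (8.8)–(8.9), Lemma 11.
* [Hata1992] M. Hata, Acta Arith. 60 (1992) 335–347, §2 pp. 340–341.
-/

noncomputable section

open Finset Filter Real
open scoped Topology

namespace Literature.NumberTheory.Irrationality.Hata1992

variable {ι : Type*} {s : Finset ι} {U V : ι → ℝ} {c : ι → ℕ}

/-- The truncated product grows (by divisibility) with the cut-off `K`. [cite: Zudilin2004, §8 (8.8)] -/
theorem fracProdTrunc_dvd_of_le (u v : ℝ) (k₀ : ℕ) {K K' : ℕ} (h : K ≤ K') (n : ℕ) :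
    fracProdTrunc u v k₀ K n ∣ fracProdTrunc u v k₀ K' n :=
  Finset.prod_dvd_prod_of_subset _ _ _ (Finset.Ico_subset_Ico_right (by omega))

/-- The truncated step factor grows (by divisibility) with the cut-off `K`. [cite: Zudilin2004, §8 (8.8)–(8.9)] -/
theorem stepFactorTrunc_dvd_of_le (s : Finset ι) (U V : ι → ℝ) (c : ι → ℕ) (k₀ : ℕ) {K K' : ℕ} (h : K ≤ K') (n : ℕ) :
    stepFactorTrunc s U V c k₀ K n ∣ stepFactorTrunc s U V c k₀ K' n :=
  Finset.prod_dvd_prod_of_dvd _ _ fun i _ => pow_dvd_pow_of_dvd (fracProdTrunc_dvd_of_le (U i) (V i) k₀ h n) _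

/-- **Truncation with a growing cut-off**: if `K(n) → ∞` then for every `ε > 0`, eventually
`e^{(Σ_i c_i S(u_i,v_i,k₀) − ε)·n} ≤ stepFactorTrunc s U V c k₀ (K n) n` (from `exists_trunc_eventually_exp_le` and monotonicity) — the
form a user with valuation laws valid only for `p² > C·n` consumes with `K(n) = ⌊√(n/C)⌋ − 1`.
[cite: Hata1992, §2 pp. 340–341 ("since `L` is arbitrary"); Zudilin2004, Lemma 11] -/
theorem eventually_exp_le_stepFactorTrunc_of_tendsto (h : ∀ i ∈ s, 0 < U i ∧ U i < V i ∧ V i ≤ 1) (k₀ : ℕ)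
    {K : ℕ → ℕ} (hK : Tendsto K atTop atTop) {ε : ℝ} (hε : 0 < ε) :
    ∀ᶠ n : ℕ in atTop,
      Real.exp ((∑ i ∈ s, (c i : ℝ) * fracRate (U i) (V i) k₀ - ε) * n) ≤ (stepFactorTrunc s U V c k₀ (K n) n : ℕ) := by
  obtain ⟨K₀, hK₀⟩ := exists_trunc_eventually_exp_le (c := c) h k₀ hε
  filter_upwards [hK₀, hK.eventually (eventually_ge_atTop K₀)] with n hn hKn
  refine hn.trans ?_
  exact_mod_cast Nat.le_of_dvd (stepFactorTrunc_pos s U V c k₀ (K n) n) (stepFactorTrunc_dvd_of_le s U V c k₀ hKn n)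

end Literature.NumberTheory.Irrationality.Hata1992
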